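import Literature.Probability.LatticeModels.SharpnessLROProofs
import HarnessLib

/-!
# THE MEAN ENERGY-PLUS-FIELD OF A BOX AND THE `β`-CHORDS OF THE PRESSURE AT FIELD `h ≥ 0`:
# `Σᵢ ⟨σ_0σ_{eᵢ}⟩⁺_{β',h} + h⟨σ_0⟩⁺_{β',h} ≤ (ψ(β,h) − ψ(β',h))/(β − β') ≤ Σᵢ ⟨σ_0σ_{eᵢ}⟩^∅_{β,h} + h⟨σ_0⟩^∅_{β,h}` (`0 ≤ β' < β`)
# (Friedli–Velenik 2017, Lemma 3.5 / Exercise 3.2, Thm. 3.6, Exercise 3.12; Lebowitz 1977, §3, p. 470)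

Claimed R42 (8)(c) in the cell INBOX at 2026-08-29T01:14:38Z by fkp-10a gen 357 (NEW CLAIM #2 of the gen), addressed to coordinator fk-4 gen 288 (seated 01:00Z 2026-08-29 by l.8634; R160 = row FO-10a-g357); lineage row FO-10a-g357f (self-suggested), package g357-field, label HF-C.
Helper file of the `fk-continuity` build cell (bschramm lane; `--supports stmt-CriticalPhenomena-4575`); builds on
p205010 (kernel theorem, internal audit signed; external expert review pending). No definitions, no named facts, no
sorries; standard axioms. UNCONDITIONAL (nearest-neighbour Ising model on `ℤ^d`, every `d`, `β ≥ 0`, `h ≥ 0`).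

In the tree's parametrisation the Boltzmann weight is `exp(β(Σ_e σ_e + h Σ_x σ_x))`, so `∂/∂β log Z^{bc}_{Λ;β,h} =
⟨−H^{bc}_{Λ;h}⟩^{bc}_{Λ;β,h} = Σ_e ⟨σ_e⟩ + h Σ_x ⟨σ_x⟩` and the natural infinite-volume `β`-slope of `ψ(·,h)` is the
energy-plus-field density `E^{bc}(β,h) = Σᵢ ⟨σ_0σ_{eᵢ}⟩^{bc}_{β,h} + h ⟨σ_0⟩^{bc}_{β,h}`. This file extends the zero-field box
bounds of the tree (`isingExpect_neg_hamiltonian_free_box_le`, `le_isingExpect_neg_hamiltonian_plus_box`,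
`SharpnessLROProofs`) and the zero-field chords (`GibbsEnergyBounds`, `PressureBetaConvexity`) to `h ≥ 0`:

* `isingExpect_neg_hamiltonian_eq` — `⟨−H^{bc}_{Λ;h}⟩ = Σ_{e∈ℰ^{bc}_Λ} ⟨σ_e⟩ + h Σ_{x∈Λ} ⟨σ_x⟩` (any graph, volume, field, b.c.);
* `isingExpect_plus_bondSpin_nonneg_field` — GKS I for the bonds of the `+` condition (boundary bonds included) at `h ≥ 0`;
* `plusCorr_pair_shift_field`, `freeCorr_pair_shift_field`, `plusCorr_singleton_shift_field`, `freeCorr_singleton_shift_field`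
  — translation invariance of the pair / one-point functions at field `h`;
* **`isingExpect_neg_hamiltonian_free_box_le_field`** — `⟨−H^∅_{B(L);h}⟩^∅_{B(L);β,h} ≤ |B(L)| E^∅(β,h)`;
  **`le_isingExpect_neg_hamiltonian_plus_box_field`** — `|B(L)| E⁺(β,h) ≤ ⟨−H⁺_{B(L+1);h}⟩⁺_{B(L+1);β,h}`;
* **`mul_le_pressure_sub_pressure_field`**, **`pressure_sub_pressure_le_mul_field`** — the chords
  `(β − β') E⁺(β',h) ≤ ψ(β,h) − ψ(β',h) ≤ (β − β') E^∅(β,h)` for `0 ≤ β' < β` (Gibbs–Jensen in the boxes with `+` / free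
  boundary condition and `ψ^{bc}_{B(L)} → ψ`); `slope_pressure_beta_mem_Icc_field`, `slope_pressure_beta_le_field`,
  `freeEnergyField_le_plusEnergyField` (`E^∅ ≤ E⁺`).

These feed the one-sided `β`-derivatives at field `h` (`PressureBetaDerivativeField`).

## References

* S. Friedli, Y. Velenik, *Statistical Mechanics of Lattice Systems*, CUP (2017), §3.1 (3.2)/(3.6), Lemma 3.5, Exercise 3.2,
  Thm. 3.6, Exercise 3.12, Thm. 3.17, Exercise 3.16, Thm. 3.20. [FriedliVelenik2017]
* J. L. Lebowitz, *Coexistence of phases in Ising ferromagnets*, J. Stat. Phys. 16 (1977) 463–476, §3, p. 470. [Lebowitz1977]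
-/

noncomputable section

namespace Summit.CriticalPhenomena.PercolationContinuityZ3.Theorems.FK

namespace IsingEnergyDensity

open MeasureTheory Filter Topology Finset Set
open Literature.Probability.LatticeModels

variable {d : ℕ}

/-! ### Finite volume: the mean of `−H` with the field term, GKS I for the plus boundary bonds -/

section FiniteVolume

variable {V : Type*} (G : SimpleGraph V) [DecidableEq V] [G.LocallyFinite]

/-- **`⟨−H^{bc}_{Λ;h}⟩^{bc}_{Λ;β,h} = Σ_{e ∈ ℰ^{bc}_Λ} ⟨σ_e⟩^{bc}_{Λ;β,h} + h Σ_{x∈Λ} ⟨σ_x⟩^{bc}_{Λ;β,h}`** (linearity; the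
`β`-derivative of `log Z^{bc}_{Λ;β,h}` in the tree's parametrisation). [cite: FriedliVelenik2017, §3.1 eqs. (3.2), (3.6) and Exercise 3.2] -/
theorem isingExpect_neg_hamiltonian_eq (Λ : Finset V) (β h : ℝ) (bc : BoundaryCondition V) :
    isingExpect G Λ β h bc (fun σ => -isingHamiltonian G Λ h bc σ) =
      ∑ e ∈ interactionEdges G Λ bc, isingExpect G Λ β h bc (fun σ => bondSpin σ e) +
        h * ∑ x ∈ Λ, isingCorr G Λ β h bc {x} := by
  have hH : (fun σ => -isingHamiltonian G Λ h bc σ) =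
      fun σ => (∑ e ∈ interactionEdges G Λ bc, bondSpin σ e) + h * ∑ x ∈ Λ, spinAt x σ := by
    funext σ
    simp only [isingHamiltonian]
    ring
  have hm1 : Measurable fun σ : SpinConfig V => ∑ e ∈ interactionEdges G Λ bc, bondSpin σ e :=
    Finset.measurable_sum _ fun e _ => measurable_bondSpin e
  have hm2 : Measurable fun σ : SpinConfig V => ∑ x ∈ Λ, spinAt x σ :=
    Finset.measurable_sum _ fun x _ => measurable_spinAt x
  rw [hH, isingExpect_add' G Λ h bc β hm1 (hm2.const_mul h),
    isingExpect_finset_sum' G Λ h bc β _ _ (fun e => measurable_bondSpin e),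
    isingExpect_const_mul' G Λ h bc β _ hm2, isingExpect_finset_sum' G Λ h bc β _ _ (fun x => measurable_spinAt x)]
  simp only [isingCorr, spinProduct_singleton]

/-- **GKS I for bond observables under the `+` boundary condition, in a field `h ≥ 0`**: for `β ≥ 0` and an edge `e`
of the graph, `⟨σ_e⟩⁺_{Λ;β,h} ≥ 0`, including the boundary edges (the tree's `isingExpect_plus_bondSpin_nonneg` is the
case `h = 0`; same proof, all GKS couplings being `≥ 0` for `h ≥ 0`). [cite: FriedliVelenik2017, Thm. 3.20, eq. (3.21)] -/
theorem isingExpect_plus_bondSpin_nonneg_field (Λ : Finset V) {β h : ℝ} (hβ : 0 ≤ β) (hh : 0 ≤ h) {e : Sym2 V}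
    (he : e ∈ G.edgeSet) : 0 ≤ isingExpect G Λ β h .plus (fun σ => bondSpin σ e) := by
  classical
  rw [isingExpect, integral_isingMeasure G Λ β h .plus (measurable_bondSpin e)]
  refine div_nonneg ?_ (isingPartitionFunction_pos G Λ β h .plus).le
  induction e using Sym2.ind with
  | _ x y =>
    have hxy : x ≠ y := G.ne_of_adj (by rwa [SimpleGraph.mem_edgeSet] at he)
    have hcfg : ∀ τ : Λ → ℤˣ, bondSpin (glue Λ τ .plus) s(x, y) =
        spinProduct (isingSupp Λ (.inl s(x, y))) τ := by
      intro τ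
      rw [spinProduct_isingSupp_inl τ .plus hxy, bondSpin_mk]
      have hout : ∀ z : V, z ∉ Λ → spinAt z (glue Λ τ .plus) = 1 := fun z hz => by
        rw [spinAt_glue_of_not_mem τ .plus hz]
        simp [spinAt, plus_outside_apply]
      congr 1
      · split_ifs with hx
        · rfl
        · exact hout x hx
      · split_ifs with hy
        · rfl
        · exact hout y hy
    have hsum : ∑ τ : Λ → ℤˣ, isingWeight G Λ β h .plus τ * bondSpin (glue Λ τ .plus) s(x, y) =
        gksSum (isingIdx G Λ) (gksCoupling G Λ β h .plus) (isingSupp Λ)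
          (spinProduct (isingSupp Λ (.inl s(x, y)))) := by
      rw [gksSum]
      refine Finset.sum_congr rfl fun τ _ => ?_
      rw [isingWeight_eq_gksWeight, hcfg τ, mul_comm]
    rw [hsum]
    exact gksSum_spinProduct_nonneg _ _ _ (gksCoupling_nonneg G hβ hh (Or.inr rfl)) _

end FiniteVolume

/-! ### Translation invariance at field `h` and the box energy bounds with the field term -/

/-- `⟨σ_yσ_{y+v}⟩⁺_{β,h} = ⟨σ_0σ_v⟩⁺_{β,h}` (`β, h ≥ 0`). [cite: FriedliVelenik2017, Thm. 3.17] -/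
theorem plusCorr_pair_shift_field {β h : ℝ} (hβ : 0 ≤ β) (hh : 0 ≤ h) (y v : Site d) :
    plusCorr d β h {y, y + v} = plusCorr d β h {0, v} := by
  rw [pair_add_eq_map_shift, plusCorr_shift d hβ hh]

/-- `⟨σ_yσ_{y+v}⟩^∅_{β,h} = ⟨σ_0σ_v⟩^∅_{β,h}` (`β, h ≥ 0`). [cite: FriedliVelenik2017, Exercise 3.16] -/
theorem freeCorr_pair_shift_field {β h : ℝ} (hβ : 0 ≤ β) (hh : 0 ≤ h) (y v : Site d) :
    freeCorr d β h {y, y + v} = freeCorr d β h {0, v} := by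
  rw [pair_add_eq_map_shift, freeCorr_shift d hβ hh]

/-- `⟨σ_x⟩⁺_{β,h} = ⟨σ_0⟩⁺_{β,h}` (`β, h ≥ 0`). [cite: FriedliVelenik2017, Thm. 3.17] -/
theorem plusCorr_singleton_shift_field {β h : ℝ} (hβ : 0 ≤ β) (hh : 0 ≤ h) (x : Site d) :
    plusCorr d β h {x} = plusCorr d β h {0} := by
  have hx : ({0} : Finset (Site d)).map (Site.shift x).toEmbedding = {x} := by
    rw [Finset.map_singleton]
    simp [Site.shift]
  rw [← hx, plusCorr_shift d hβ hh]

/-- `⟨σ_x⟩^∅_{β,h} = ⟨σ_0⟩^∅_{β,h}` (`β, h ≥ 0`). [cite: FriedliVelenik2017, Exercise 3.16] -/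
theorem freeCorr_singleton_shift_field {β h : ℝ} (hβ : 0 ≤ β) (hh : 0 ≤ h) (x : Site d) :
    freeCorr d β h {x} = freeCorr d β h {0} := by
  have hx : ({0} : Finset (Site d)).map (Site.shift x).toEmbedding = {x} := by
    rw [Finset.map_singleton]
    simp [Site.shift]
  rw [← hx, freeCorr_shift d hβ hh]

/-- **Free mean of `−H` in a box, upper bound with the field term**: for `β, h ≥ 0`,
`⟨−H^∅_{B(L);h}⟩^∅_{B(L);β,h} ≤ |B(L)| (Σᵢ ⟨σ_0σ_{eᵢ}⟩^∅_{β,h} + h ⟨σ_0⟩^∅_{β,h})` (free finite-volume correlations are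
below their infinite-volume values, GKS II; translation invariance). [cite: FriedliVelenik2017, Exercise 3.12 and Exercise 3.16] -/
theorem isingExpect_neg_hamiltonian_free_box_le_field {β h : ℝ} (hβ : 0 ≤ β) (hh : 0 ≤ h) (L : ℕ) :
    isingExpect (zdGraph d) (box d L) β h .free
        (fun σ => -isingHamiltonian (zdGraph d) (box d L) h .free σ) ≤
      #(box d L) * (∑ i, freeCorr d β h {0, Pi.single i 1} + h * freeCorr d β h {0}) := by
  rw [isingExpect_neg_hamiltonian_eq, interactionEdges_free, sum_edgesIn_zd, mul_add]
  refine add_le_add ?_ ?_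
  · rw [Finset.mul_sum]
    refine Finset.sum_le_sum fun i _ => ?_
    calc ∑ y ∈ (box d L).filter (fun y => y + Pi.single i 1 ∈ box d L),
          isingExpect (zdGraph d) (box d L) β h .free (fun σ => bondSpin σ s(y, y + Pi.single i 1))
        ≤ ∑ y ∈ (box d L).filter (fun y => y + Pi.single i 1 ∈ box d L), freeCorr d β h {0, Pi.single i 1} := by
          refine Finset.sum_le_sum fun y hy => ?_
          rw [Finset.mem_filter] at hy
          rw [isingExpect_bondSpin_mk _ _ _ _ _ (ne_add_unitVec y i), ← freeCorr_pair_shift_field hβ hh y (Pi.single i 1)]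
          refine isingCorr_free_box_le_freeCorr hβ hh ?_
          intro z hz
          simp only [Finset.mem_insert, Finset.mem_singleton] at hz
          rcases hz with rfl | rfl
          · exact hy.1
          · exact hy.2
      _ = #((box d L).filter (fun y => y + Pi.single i 1 ∈ box d L)) * freeCorr d β h {0, Pi.single i 1} := by
          rw [Finset.sum_const, nsmul_eq_mul]
      _ ≤ #(box d L) * freeCorr d β h {0, Pi.single i 1} :=
          mul_le_mul_of_nonneg_right (Nat.cast_le.2 (Finset.card_le_card (Finset.filter_subset _ _)))
            (freeCorr_nonneg hβ hh _)
  · rw [← mul_assoc, mul_comm (#(box d L) : ℝ) h, mul_assoc]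
    refine mul_le_mul_of_nonneg_left ?_ hh
    calc ∑ x ∈ box d L, isingCorr (zdGraph d) (box d L) β h .free {x} ≤ ∑ x ∈ box d L, freeCorr d β h {x} :=
          Finset.sum_le_sum fun x hx => isingCorr_free_box_le_freeCorr hβ hh (Finset.singleton_subset_iff.2 hx)
      _ = #(box d L) * freeCorr d β h {0} := by
          rw [Finset.sum_congr rfl fun x _ => freeCorr_singleton_shift_field hβ hh x, Finset.sum_const, nsmul_eq_mul]

/-- **Plus mean of `−H` in a box, lower bound with the field term**: for `β, h ≥ 0`,
`|B(L)| (Σᵢ ⟨σ_0σ_{eᵢ}⟩⁺_{β,h} + h ⟨σ_0⟩⁺_{β,h}) ≤ ⟨−H⁺_{B(L+1);h}⟩⁺_{B(L+1);β,h}` (boundary bonds `≥ 0` by GKS I; plus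
finite-volume correlations are above their infinite-volume values; every `y ∈ B(L)` starts an edge of `B(L+1)` in each
direction; the field sum over `B(L+1) ⊇ B(L)` has nonnegative terms). [cite: FriedliVelenik2017, Exercise 3.12 and Thm. 3.17] -/
theorem le_isingExpect_neg_hamiltonian_plus_box_field {β h : ℝ} (hβ : 0 ≤ β) (hh : 0 ≤ h) (L : ℕ) :
    (#(box d L) : ℝ) * (∑ i, plusCorr d β h {0, Pi.single i 1} + h * plusCorr d β h {0}) ≤
      isingExpect (zdGraph d) (box d (L + 1)) β h .plus
        (fun σ => -isingHamiltonian (zdGraph d) (box d (L + 1)) h .plus σ) := by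
  have hIE : interactionEdges (zdGraph d) (box d (L + 1)) .plus = edgesTouching (zdGraph d) (box d (L + 1)) :=
    rfl
  rw [isingExpect_neg_hamiltonian_eq, hIE, mul_add, Finset.mul_sum]
  refine add_le_add ?_ ?_
  · calc ∑ i, (#(box d L) : ℝ) * plusCorr d β h {0, Pi.single i 1}
        = ∑ i, ∑ y ∈ box d L, plusCorr d β h {y, y + Pi.single i 1} := by
          refine Finset.sum_congr rfl fun i _ => ?_
          rw [Finset.sum_congr rfl fun y _ => plusCorr_pair_shift_field hβ hh y (Pi.single i 1), Finset.sum_const,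
            nsmul_eq_mul]
      _ ≤ ∑ i, ∑ y ∈ (box d (L + 1)).filter (fun y => y + Pi.single i 1 ∈ box d (L + 1)),
            plusCorr d β h {y, y + Pi.single i 1} := by
          refine Finset.sum_le_sum fun i _ => ?_
          exact Finset.sum_le_sum_of_subset_of_nonneg (box_subset_filter_box_succ i L)
            fun y _ _ => plusCorr_nonneg hβ hh _
      _ ≤ ∑ i, ∑ y ∈ (box d (L + 1)).filter (fun y => y + Pi.single i 1 ∈ box d (L + 1)),
            isingExpect (zdGraph d) (box d (L + 1)) β h .plus (fun σ => bondSpin σ s(y, y + Pi.single i 1)) := by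
          refine Finset.sum_le_sum fun i _ => Finset.sum_le_sum fun y hy => ?_
          rw [Finset.mem_filter] at hy
          rw [isingExpect_bondSpin_mk _ _ _ _ _ (ne_add_unitVec y i)]
          refine plusCorr_le_isingCorr_plus_box hβ hh ?_
          intro z hz
          simp only [Finset.mem_insert, Finset.mem_singleton] at hz
          rcases hz with rfl | rfl
          · exact hy.1
          · exact hy.2
      _ = ∑ e ∈ edgesIn (zdGraph d) (box d (L + 1)),
            isingExpect (zdGraph d) (box d (L + 1)) β h .plus (fun σ => bondSpin σ e) :=
          (sum_edgesIn_zd (box d (L + 1))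
            (fun e => isingExpect (zdGraph d) (box d (L + 1)) β h .plus (fun σ => bondSpin σ e))).symm
      _ ≤ ∑ e ∈ edgesTouching (zdGraph d) (box d (L + 1)),
            isingExpect (zdGraph d) (box d (L + 1)) β h .plus (fun σ => bondSpin σ e) := by
          refine Finset.sum_le_sum_of_subset_of_nonneg (edgesIn_subset_edgesTouching _) ?_
          intro e he _
          exact isingExpect_plus_bondSpin_nonneg_field (zdGraph d) _ hβ hh (mem_edgesTouching_iff.1 he).1
  · rw [← mul_assoc, mul_comm (#(box d L) : ℝ) h, mul_assoc]
    refine mul_le_mul_of_nonneg_left ?_ hh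
    calc (#(box d L) : ℝ) * plusCorr d β h {0} = ∑ x ∈ box d L, plusCorr d β h {x} := by
          rw [Finset.sum_congr rfl fun x _ => plusCorr_singleton_shift_field hβ hh x, Finset.sum_const, nsmul_eq_mul]
      _ ≤ ∑ x ∈ box d (L + 1), plusCorr d β h {x} :=
          Finset.sum_le_sum_of_subset_of_nonneg (box_mono d (Nat.le_succ L)) fun x _ _ => plusCorr_nonneg hβ hh _
      _ ≤ ∑ x ∈ box d (L + 1), isingCorr (zdGraph d) (box d (L + 1)) β h .plus {x} :=
          Finset.sum_le_sum fun x hx => plusCorr_le_isingCorr_plus_box hβ hh (Finset.singleton_subset_iff.2 hx)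

/-! ### The `β`-chords of `ψ(·,h)` at field `h ≥ 0` -/

/-- **Lower chord bound (plus boundary condition) at field `h ≥ 0`**: for `0 ≤ β' < β`,
`(β − β') (Σᵢ ⟨σ_0σ_{eᵢ}⟩⁺_{β',h} + h ⟨σ_0⟩⁺_{β',h}) ≤ ψ(β,h) − ψ(β',h)`.
[cite: Lebowitz1977, §3, proof of Thm. 2, p. 470; FriedliVelenik2017, Thm. 3.6 and Exercise 3.2] -/
theorem mul_le_pressure_sub_pressure_field {β' β h : ℝ} (hβ' : 0 ≤ β') (hlt : β' < β) (hh : 0 ≤ h) :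
    (β - β') * (∑ i, plusCorr d β' h {0, Pi.single i 1} + h * plusCorr d β' h {0}) ≤
      pressure d β h - pressure d β' h := by
  have hδ : 0 < β - β' := sub_pos.2 hlt
  set P := ∑ i, plusCorr d β' h {0, Pi.single i 1} + h * plusCorr d β' h {0} with hP
  have hN : ∀ L : ℕ, (0 : ℝ) < #(box d (L + 1)) := fun L => by
    exact_mod_cast Finset.card_pos.2 (box_nonempty d (L + 1))
  have h1 : ∀ L : ℕ, (β - β') * ((#(box d L) : ℝ) / #(box d (L + 1))) * P ≤
      pressureIn (zdGraph d) (box d (L + 1)) β h .plus - pressureIn (zdGraph d) (box d (L + 1)) β' h .plus := by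
    intro L
    have hJ := mul_isingExpect_neg_hamiltonian_le_log_sub (zdGraph d) (box d (L + 1)) β' β h .plus
    have hE := le_isingExpect_neg_hamiltonian_plus_box_field (d := d) hβ' hh L
    have hb : (#(box d (L + 1)) : ℝ) ≠ 0 := (hN L).ne'
    rw [pressureIn, pressureIn, ← sub_div, le_div_iff₀ (hN L)]
    calc (β - β') * ((#(box d L) : ℝ) / #(box d (L + 1))) * P * #(box d (L + 1))
        = (β - β') * (#(box d L) * P) := by field_simp
      _ ≤ (β - β') * isingExpect (zdGraph d) (box d (L + 1)) β' h .plus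
            (fun σ => -isingHamiltonian (zdGraph d) (box d (L + 1)) h .plus σ) :=
          mul_le_mul_of_nonneg_left hE hδ.le
      _ ≤ _ := hJ
  have hlim : Tendsto (fun L : ℕ => pressureIn (zdGraph d) (box d (L + 1)) β h .plus -
        pressureIn (zdGraph d) (box d (L + 1)) β' h .plus) atTop (𝓝 (pressure d β h - pressure d β' h)) :=
    ((hasBoxLimit_pressureIn_holds d β h .plus).comp (tendsto_add_atTop_nat 1)).sub
      ((hasBoxLimit_pressureIn_holds d β' h .plus).comp (tendsto_add_atTop_nat 1))
  have hl : Tendsto (fun L : ℕ => (β - β') * ((#(box d L) : ℝ) / #(box d (L + 1))) * P) atTop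
      (𝓝 ((β - β') * 1 * P)) :=
    (tendsto_const_nhds.mul (tendsto_card_box_div_card_box_succ d)).mul tendsto_const_nhds
  rw [mul_one] at hl
  exact le_of_tendsto_of_tendsto hl hlim (Eventually.of_forall h1)

/-- **Upper chord bound (free boundary condition) at field `h ≥ 0`**: for `0 ≤ β`, `β' < β`,
`ψ(β,h) − ψ(β',h) ≤ (β − β') (Σᵢ ⟨σ_0σ_{eᵢ}⟩^∅_{β,h} + h ⟨σ_0⟩^∅_{β,h})`.
[cite: Lebowitz1977, §3, proof of Thm. 2, p. 470; FriedliVelenik2017, Thm. 3.6 and Exercise 3.2] -/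
theorem pressure_sub_pressure_le_mul_field {β' β h : ℝ} (hβ : 0 ≤ β) (hlt : β' < β) (hh : 0 ≤ h) :
    pressure d β h - pressure d β' h ≤
      (β - β') * (∑ i, freeCorr d β h {0, Pi.single i 1} + h * freeCorr d β h {0}) := by
  have hδ : 0 < β - β' := sub_pos.2 hlt
  set F := ∑ i, freeCorr d β h {0, Pi.single i 1} + h * freeCorr d β h {0} with hF
  have hN : ∀ L : ℕ, (0 : ℝ) < #(box d L) := fun L => by
    exact_mod_cast Finset.card_pos.2 (box_nonempty d L)
  have h2 : ∀ L : ℕ, pressureIn (zdGraph d) (box d L) β h .free - pressureIn (zdGraph d) (box d L) β' h .free ≤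
      (β - β') * F := by
    intro L
    have hJ := mul_isingExpect_neg_hamiltonian_le_log_sub (zdGraph d) (box d L) β β' h .free
    have hE := isingExpect_neg_hamiltonian_free_box_le_field (d := d) hβ hh L
    rw [pressureIn, pressureIn, ← sub_div, div_le_iff₀ (hN L)]
    have hE' : (β - β') * isingExpect (zdGraph d) (box d L) β h .free
        (fun σ => -isingHamiltonian (zdGraph d) (box d L) h .free σ) ≤ (β - β') * (#(box d L) * F) :=
      mul_le_mul_of_nonneg_left hE hδ.le
    nlinarith [hJ, hE']
  have hlim : Tendsto (fun L : ℕ => pressureIn (zdGraph d) (box d L) β h .free -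
      pressureIn (zdGraph d) (box d L) β' h .free) atTop (𝓝 (pressure d β h - pressure d β' h)) :=
    (hasBoxLimit_pressureIn_holds (d := d) β h .free).sub (hasBoxLimit_pressureIn_holds (d := d) β' h .free)
  exact le_of_tendsto' hlim h2

/-- The slope sandwich at field `h ≥ 0`: for `0 ≤ β' < β`,
`Σᵢ ⟨σ_0σ_{eᵢ}⟩⁺_{β',h} + h⟨σ_0⟩⁺_{β',h} ≤ slope ψ(·,h) β' β ≤ Σᵢ ⟨σ_0σ_{eᵢ}⟩^∅_{β,h} + h⟨σ_0⟩^∅_{β,h}`.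
[cite: Lebowitz1977, §3, proof of Thm. 2, p. 470] -/
theorem slope_pressure_beta_mem_Icc_field {β' β h : ℝ} (hβ' : 0 ≤ β') (hlt : β' < β) (hh : 0 ≤ h) :
    slope (fun b => pressure d b h) β' β ∈
      Icc (∑ i, plusCorr d β' h {0, Pi.single i 1} + h * plusCorr d β' h {0})
        (∑ i, freeCorr d β h {0, Pi.single i 1} + h * freeCorr d β h {0}) := by
  rw [slope_def_field, Set.mem_Icc, le_div_iff₀ (sub_pos.2 hlt), div_le_iff₀ (sub_pos.2 hlt)]
  have h1 := mul_le_pressure_sub_pressure_field (d := d) hβ' hlt hh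
  have h2 := pressure_sub_pressure_le_mul_field (d := d) (hβ'.trans hlt.le) hlt hh
  constructor <;> linarith [mul_comm (β - β') (∑ i, plusCorr d β' h {0, Pi.single i 1} + h * plusCorr d β' h {0}),
    mul_comm (β - β') (∑ i, freeCorr d β h {0, Pi.single i 1} + h * freeCorr d β h {0})]

/-- `E^∅(β,h) ≤ E⁺(β,h)`: `Σᵢ ⟨σ_0σ_{eᵢ}⟩^∅_{β,h} + h⟨σ_0⟩^∅_{β,h} ≤ Σᵢ ⟨σ_0σ_{eᵢ}⟩⁺_{β,h} + h⟨σ_0⟩⁺_{β,h}` (`β, h ≥ 0`).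
[cite: FriedliVelenik2017, Lemma 3.31] -/
theorem freeEnergyField_le_plusEnergyField {β h : ℝ} (hβ : 0 ≤ β) (hh : 0 ≤ h) :
    ∑ i, freeCorr d β h {0, Pi.single i 1} + h * freeCorr d β h {0} ≤
      ∑ i, plusCorr d β h {0, Pi.single i 1} + h * plusCorr d β h {0} :=
  add_le_add (sum_le_sum fun _ _ => freeCorr_le_plusCorr hβ hh _)
    (mul_le_mul_of_nonneg_left (freeCorr_le_plusCorr hβ hh _) hh)

/-- The upper slope bound needs only `0 ≤ β`: for `β' < β`, `h ≥ 0`,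
`slope ψ(·,h) β' β ≤ Σᵢ ⟨σ_0σ_{eᵢ}⟩^∅_{β,h} + h⟨σ_0⟩^∅_{β,h}`. [cite: Lebowitz1977, §3, proof of Thm. 2, p. 470] -/
theorem slope_pressure_beta_le_field {β' β h : ℝ} (hβ : 0 ≤ β) (hlt : β' < β) (hh : 0 ≤ h) :
    slope (fun b => pressure d b h) β' β ≤ ∑ i, freeCorr d β h {0, Pi.single i 1} + h * freeCorr d β h {0} := by
  rw [slope_def_field, div_le_iff₀ (sub_pos.2 hlt)]
  have h2 := pressure_sub_pressure_le_mul_field (d := d) hβ hlt hh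
  linarith [mul_comm (β - β') (∑ i, freeCorr d β h {0, Pi.single i 1} + h * freeCorr d β h {0})]

end IsingEnergyDensity

end Summit.CriticalPhenomena.PercolationContinuityZ3.Theorems.FK

end
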